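import Mathlib.FieldTheory.IntermediateField.Adjoin.Basic
import Mathlib.FieldTheory.Minpoly.Field
import Literature.NumberTheory.Transcendental.HeightLocalGlobal
import Literature.NumberTheory.Transcendental.PadicLiouvilleInequality
import Literature.NumberTheory.EllipticCurves.PAdicHeights
import HarnessLib

/-!
# The Mahler–Manin theorem, fourth step: the Liouville estimate at `q^ℓ`

Everything in this file is **proved**; there are no new definitions.  Fourth step of the `p`-adic
proof of the Mahler–Manin conjecture after Barré-Sirieix–Diaz–Gramain–Philibert (1996)
(Nesterenko–Philippon LNM 1752, Ch. 2, §2.5, fourth step, with Lemmas 2.8–2.10): a LOWER bound for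
the non-zero `p`-adic number

  `v = Σ_{λ ∈ s} a_λ (q^ℓ)^{λ₁} (q^ℓ J(q^ℓ))^{λ₂}`   (`= F_a(q^ℓ)`, the value of the auxiliary function)

when `q` and `J(q)` are algebraic and `J(q^ℓ)` is tied to `J(q)` by an integer modular relation
`Φ(J(q^ℓ), J(q)) = 0`, `Φ ∈ ℤ[X][Y]` monic in `X`:

* `neg_log_norm_auxValue_le` — there are constants `d₀ ≥ 1`, `c_q, c_J ≥ 0` depending only on
  `q` such that for every `ℓ ≥ 1`, every such `Φ` with coefficients of degree `≤ D_Y` in `Y` and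
  length `L(Φ) = Σ |coeff|`, and every `a` supported on exponents `λ₁ ≤ B₁`, `λ₂ ≤ B₂`:

  `-log ‖v‖_p ≤ d₀ · deg_X Φ · [log⁺ L(a) + ℓ (B₁ + B₂) c_q + B₂ (log⁺ L(Φ) + D_Y c_J)]`.

Ingredients: the number field `K = ℚ(q, J(q), J(q^ℓ)) ⊂ ℚ_p` of degree `≤ d₀ deg_X Φ`
(`isIntegral_and_finrank_adjoin_le`), the `p`-adic Liouville inequality `log ‖σ x‖_p ≥ -h_K(x)`
(`PadicLiouvilleInequality.lean`), the local-to-global height bounds of `HeightLocalGlobal.lean`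
(`h_K(P(α, β)) ≤ [K:ℚ] log L(P) + deg_α h_K(α) + deg_β h_K(β)`, the height of a root of a monic
relation, and `h_K(q), h_K(J(q)) = O([K:ℚ])` for the fixed algebraic numbers `q`, `J(q)`).

## References

* [BarreSirieixDiazGramainPhilibert1996Manin] Invent. Math. 124 (1996) 1–9, §4.
* [NesterenkoPhilippon2001] LNM 1752, Ch. 2 (G. Diaz), Lemmas 2.8, 2.10 and §2.5, fourth step.
-/

noncomputable section

open Finset Polynomial Height Height.AdmissibleAbsValues NumberField
  Literature.NumberTheory.EllipticCurves

namespace Literature.NumberTheory.Transcendental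

/-! ### Local estimates in one and two variables with prescribed exponents -/

section Local

variable {K : Type*} [Field K]

/-- One variable: `v(Σ_{i<n} cᵢ xⁱ) ≤ (Σ |cᵢ|) · max(v x, 1)^D` for `n ≤ D + 1`. [folklore] -/
theorem absValue_sum_intCast_mul_pow_le (v : AbsoluteValue K ℝ) (c : ℕ → ℤ) (x : K) {n D : ℕ}
    (hn : n ≤ D + 1) :
    v (∑ i ∈ range n, (c i : K) * x ^ i) ≤ (∑ i ∈ range n, |(c i : ℝ)|) * max (v x) 1 ^ D := by
  rw [sum_mul]
  refine (v.sum_le _ _).trans (sum_le_sum fun i hi ↦ ?_)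
  rw [map_mul, map_pow]
  have hi' : i ≤ D := by have := mem_range.mp hi; omega
  have hpow : v x ^ i ≤ max (v x) 1 ^ D :=
    (pow_le_pow_left₀ (v.nonneg x) (le_max_left _ _) i).trans
      (pow_le_pow_right₀ (le_max_right _ _) hi')
  exact mul_le_mul (absValue_intCast_le v (c i)) hpow (pow_nonneg (v.nonneg x) i) (abs_nonneg _)

/-- One variable, non-archimedean: `v(Σ_{i<n} cᵢ xⁱ) ≤ max(v x, 1)^D` for `n ≤ D + 1`. [folklore] -/
theorem absValue_sum_intCast_mul_pow_le_of_isNonarchimedean {v : AbsoluteValue K ℝ}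
    (hv : IsNonarchimedean v) (c : ℕ → ℤ) (x : K) {n D : ℕ} (hn : n ≤ D + 1) :
    v (∑ i ∈ range n, (c i : K) * x ^ i) ≤ max (v x) 1 ^ D := by
  rcases (range n).eq_empty_or_nonempty with h | h
  · rw [h, sum_empty, map_zero]
    positivity
  refine (hv.apply_sum_le_sup h).trans (sup'_le h _ fun i hi ↦ ?_)
  rw [map_mul, map_pow]
  have hi' : i ≤ D := by have := mem_range.mp hi; omega
  have hpow : v x ^ i ≤ max (v x) 1 ^ D :=
    (pow_le_pow_left₀ (v.nonneg x) (le_max_left _ _) i).trans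
      (pow_le_pow_right₀ (le_max_right _ _) hi')
  calc v (c i : K) * v x ^ i ≤ 1 * max (v x) 1 ^ D :=
        mul_le_mul hv.apply_intCast_le_one hpow (pow_nonneg (v.nonneg x) i) zero_le_one
    _ = _ := one_mul _

/-- Two variables with exponent maps: `v(Σ_{λ ∈ s} a_λ α^{e₁ λ} β^{e₂ λ}) ≤
(Σ |a_λ|) max(v α, 1)^{D₁} max(v β, 1)^{D₂}` when `e₁ ≤ D₁`, `e₂ ≤ D₂` on `s`. [folklore] -/
theorem absValue_sum_intCast_mul_pow_mul_pow_le {ι : Type*} (v : AbsoluteValue K ℝ) (s : Finset ι)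
    (a : ι → ℤ) (e₁ e₂ : ι → ℕ) (α β : K) {D₁ D₂ : ℕ} (hD : ∀ l ∈ s, e₁ l ≤ D₁ ∧ e₂ l ≤ D₂) :
    v (∑ l ∈ s, (a l : K) * α ^ e₁ l * β ^ e₂ l) ≤
      (∑ l ∈ s, |(a l : ℝ)|) * max (v α) 1 ^ D₁ * max (v β) 1 ^ D₂ := by
  have hpow : ∀ (x : K) {i D : ℕ}, i ≤ D → v x ^ i ≤ max (v x) 1 ^ D := fun x i D hi ↦
    (pow_le_pow_left₀ (v.nonneg x) (le_max_left _ _) i).trans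
      (pow_le_pow_right₀ (le_max_right _ _) hi)
  rw [sum_mul, sum_mul]
  refine (v.sum_le _ _).trans (sum_le_sum fun l hl ↦ ?_)
  rw [map_mul, map_mul, map_pow, map_pow]
  have h1 := absValue_intCast_le v (a l)
  have h2 := hpow α (hD l hl).1
  have h3 := hpow β (hD l hl).2
  have := v.nonneg (a l : K)
  have := pow_nonneg (v.nonneg α) (e₁ l)
  have := pow_nonneg (v.nonneg β) (e₂ l)
  gcongr

/-- Two variables with exponent maps, non-archimedean:
`v(Σ_{λ ∈ s} a_λ α^{e₁ λ} β^{e₂ λ}) ≤ max(v α, 1)^{D₁} max(v β, 1)^{D₂}`. [folklore] -/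
theorem absValue_sum_intCast_mul_pow_mul_pow_le_of_isNonarchimedean {ι : Type*}
    {v : AbsoluteValue K ℝ} (hv : IsNonarchimedean v) (s : Finset ι) (a : ι → ℤ) (e₁ e₂ : ι → ℕ)
    (α β : K) {D₁ D₂ : ℕ} (hD : ∀ l ∈ s, e₁ l ≤ D₁ ∧ e₂ l ≤ D₂) :
    v (∑ l ∈ s, (a l : K) * α ^ e₁ l * β ^ e₂ l) ≤ max (v α) 1 ^ D₁ * max (v β) 1 ^ D₂ := by
  have hpow : ∀ (x : K) {i D : ℕ}, i ≤ D → v x ^ i ≤ max (v x) 1 ^ D := fun x i D hi ↦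
    (pow_le_pow_left₀ (v.nonneg x) (le_max_left _ _) i).trans
      (pow_le_pow_right₀ (le_max_right _ _) hi)
  rcases s.eq_empty_or_nonempty with rfl | hs
  · simp only [sum_empty, map_zero]
    positivity
  refine (hv.apply_sum_le_sup hs).trans (sup'_le hs _ fun l hl ↦ ?_)
  rw [map_mul, map_mul, map_pow, map_pow]
  have h1 : v (a l : K) ≤ 1 := hv.apply_intCast_le_one
  have h2 := hpow α (hD l hl).1
  have h3 := hpow β (hD l hl).2
  have := v.nonneg (a l : K)
  have := pow_nonneg (v.nonneg α) (e₁ l)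
  have := pow_nonneg (v.nonneg β) (e₂ l)
  calc v (a l : K) * v α ^ e₁ l * v β ^ e₂ l ≤ 1 * max (v α) 1 ^ D₁ * max (v β) 1 ^ D₂ := by
        gcongr
    _ = _ := by rw [one_mul]

end Local

/-! ### Global height bounds on a number field -/

section Global

variable {K : Type*} [Field K] [NumberField K]

/-- **Height of an integer polynomial expression with exponent maps**:
`log H(Σ a_λ α^{e₁λ} β^{e₂λ}) ≤ [K:ℚ] log⁺(Σ|a_λ|) + D₁ log H(α) + D₂ log H(β)`.
[cite: NesterenkoPhilippon2001, Ch. 2, Lemma 2.10] -/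
theorem logHeight₁_sum_intCast_mul_pow_mul_pow_le {ι : Type*} (s : Finset ι) (a : ι → ℤ)
    (e₁ e₂ : ι → ℕ) (α β : K) {D₁ D₂ : ℕ} (hD : ∀ l ∈ s, e₁ l ≤ D₁ ∧ e₂ l ≤ D₂) :
    logHeight₁ (∑ l ∈ s, (a l : K) * α ^ e₁ l * β ^ e₂ l) ≤
      Module.finrank ℚ K * Real.log (max 1 (∑ l ∈ s, |(a l : ℝ)|)) +
        D₁ * logHeight₁ α + D₂ * logHeight₁ β := by
  have hloc : ∀ v : AbsoluteValue K ℝ,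
      ∏ i : Fin 2, max (v (![α, β] i)) 1 ^ ![D₁, D₂] i = max (v α) 1 ^ D₁ * max (v β) 1 ^ D₂ :=
    fun v ↦ by rw [Fin.prod_univ_two]; rfl
  have hglob : ∏ i : Fin 2, mulHeight₁ (![α, β] i) ^ ![D₁, D₂] i =
      mulHeight₁ α ^ D₁ * mulHeight₁ β ^ D₂ := by
    rw [Fin.prod_univ_two]; rfl
  have h := mulHeight₁_le_of_forall_absValue_le (K := K) (univ : Finset (Fin 2))
    (y := ∑ l ∈ s, (a l : K) * α ^ e₁ l * β ^ e₂ l) (x := ![α, β]) (e := ![D₁, D₂])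
    (C := max 1 (∑ l ∈ s, |(a l : ℝ)|)) (le_max_left _ _) (fun v _ ↦ ?_) (fun v hv ↦ ?_)
  · rw [hglob] at h
    rw [logHeight₁_eq_log_mulHeight₁, logHeight₁_eq_log_mulHeight₁, logHeight₁_eq_log_mulHeight₁,
      ← totalWeight_eq_finrank]
    have hpos : 0 < max 1 (∑ l ∈ s, |(a l : ℝ)|) := lt_of_lt_of_le one_pos (le_max_left _ _)
    calc Real.log (mulHeight₁ (∑ l ∈ s, (a l : K) * α ^ e₁ l * β ^ e₂ l))
        ≤ Real.log ((max 1 (∑ l ∈ s, |(a l : ℝ)|)) ^ totalWeight K *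
            (mulHeight₁ α ^ D₁ * mulHeight₁ β ^ D₂)) := Real.log_le_log (mulHeight₁_pos _) h
      _ = _ := by
        rw [Real.log_mul (by positivity) (by positivity), Real.log_mul (by positivity) (by positivity),
          Real.log_pow, Real.log_pow, Real.log_pow]
        ring
  · rw [hloc, ← mul_assoc]
    refine (absValue_sum_intCast_mul_pow_mul_pow_le v s a e₁ e₂ α β hD).trans ?_
    gcongr
    exact le_max_right _ _
  · rw [hloc]
    exact absValue_sum_intCast_mul_pow_mul_pow_le_of_isNonarchimedean (isNonarchimedean v hv) s a
      e₁ e₂ α β hD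

/-- **Height of a root of a monic integer relation** (Nesterenko–Philippon Ch. 2, Lemma 2.8 in
height form).  Let `Φ = Σ_m P_m(Y) X^m ∈ ℤ[X][Y]` be monic in `X` of degree `D`, with
`deg P_m ≤ D_Y`, and let `y, J ∈ K` with `Σ_m P_m(J) y^m = 0`.  Then
`log H(y) ≤ [K:ℚ] log⁺ L(Φ) + D_Y log H(J)`, `L(Φ) = Σ_{m ≤ D} Σ_{i ≤ D_Y} |coeff|`.
[cite: NesterenkoPhilippon2001, Ch. 2, Lemma 2.8] -/
theorem logHeight₁_root_le (Φ : Polynomial (Polynomial ℤ)) (hmonic : Φ.Monic) {DY : ℕ}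
    (hDY : ∀ m, (Φ.coeff m).natDegree ≤ DY) (y J : K)
    (hrel : (Φ.map (Polynomial.aeval J).toRingHom).eval y = 0) :
    logHeight₁ y ≤ Module.finrank ℚ K *
        Real.log (max 1 (∑ m ∈ range (Φ.natDegree + 1), ∑ i ∈ range (DY + 1),
          |(((Φ.coeff m).coeff i : ℤ) : ℝ)|)) + DY * logHeight₁ J := by
  set D := Φ.natDegree with hD
  set L : ℝ := ∑ m ∈ range (D + 1), ∑ i ∈ range (DY + 1), |(((Φ.coeff m).coeff i : ℤ) : ℝ)| with hL
  -- the coefficients `b_m = P_m(J)` as sums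
  set b : ℕ → K := fun m ↦ Polynomial.aeval J (Φ.coeff m) with hb
  have hbsum : ∀ m, b m = ∑ i ∈ range (DY + 1), (((Φ.coeff m).coeff i : ℤ) : K) * J ^ i := by
    intro m
    rw [hb]
    simp only
    rw [Polynomial.aeval_eq_sum_range' (Nat.lt_succ_of_le (hDY m))]
    simp [zsmul_eq_mul]
  -- the monic relation `y^D + Σ_{m<D} b_m y^m = 0`
  have hrel' : y ^ D + ∑ m ∈ range D, b m * y ^ m = 0 := by
    rw [Polynomial.eval_map, Polynomial.eval₂_eq_sum_range, sum_range_succ] at hrel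
    have hlead : (Polynomial.aeval J).toRingHom (Φ.coeff D) = 1 := by
      rw [hD, hmonic.coeff_natDegree, map_one]
    rw [hlead, one_mul, add_comm] at hrel
    exact hrel
  -- local bounds
  have hrow : ∀ (v : AbsoluteValue K ℝ) (m : ℕ), m < D →
      v (b m) ≤ (∑ i ∈ range (DY + 1), |(((Φ.coeff m).coeff i : ℤ) : ℝ)|) * max (v J) 1 ^ DY := by
    intro v m _
    rw [hbsum]
    exact absValue_sum_intCast_mul_pow_le v (fun i ↦ (Φ.coeff m).coeff i) J le_rfl
  have hLrow : ∀ m ∈ range D,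
      (∑ i ∈ range (DY + 1), |(((Φ.coeff m).coeff i : ℤ) : ℝ)|) ≤ L := by
    intro m hm
    rw [hL]
    refine single_le_sum (f := fun m ↦ ∑ i ∈ range (DY + 1), |(((Φ.coeff m).coeff i : ℤ) : ℝ)|)
      (fun m _ ↦ sum_nonneg fun i _ ↦ abs_nonneg _) (mem_range.mpr ?_)
    have := mem_range.mp hm; omega
  have hL0 : 0 ≤ L := sum_nonneg fun m _ ↦ sum_nonneg fun i _ ↦ abs_nonneg _
  have harch : ∀ v : AbsoluteValue K ℝ, v y ≤ max 1 L * max (v J) 1 ^ DY := by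
    intro v
    refine (absValue_le_max_one_sum_of_monic v b hrel').trans ?_
    have hM : 1 ≤ max (v J) 1 ^ DY := one_le_pow₀ (le_max_right _ _)
    refine max_le ?_ ?_
    · calc (1 : ℝ) = 1 * 1 := (mul_one 1).symm
        _ ≤ max 1 L * max (v J) 1 ^ DY := mul_le_mul (le_max_left _ _) hM zero_le_one (by positivity)
    · calc ∑ m ∈ range D, v (b m)
          ≤ ∑ m ∈ range D, (∑ i ∈ range (DY + 1), |(((Φ.coeff m).coeff i : ℤ) : ℝ)|) *
              max (v J) 1 ^ DY := sum_le_sum fun m hm ↦ hrow v m (mem_range.mp hm)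
        _ = (∑ m ∈ range D, ∑ i ∈ range (DY + 1), |(((Φ.coeff m).coeff i : ℤ) : ℝ)|) *
              max (v J) 1 ^ DY := by rw [sum_mul]
        _ ≤ L * max (v J) 1 ^ DY := by
            refine mul_le_mul_of_nonneg_right ?_ (by positivity)
            rw [hL, sum_range_succ]
            exact le_add_of_nonneg_right (sum_nonneg fun i _ ↦ abs_nonneg _)
        _ ≤ max 1 L * max (v J) 1 ^ DY := by gcongr; exact le_max_right _ _
  have hna : ∀ v : AbsoluteValue K ℝ, IsNonarchimedean v → v y ≤ max (v J) 1 ^ DY := by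
    intro v hv
    have h := absValue_le_max_one_sup_of_monic hv b hrel' (B := max (v J) 1 ^ DY) fun m _ ↦ by
      rw [hbsum]
      exact absValue_sum_intCast_mul_pow_le_of_isNonarchimedean hv
        (fun i ↦ (Φ.coeff m).coeff i) J le_rfl
    rwa [max_eq_right (one_le_pow₀ (le_max_right _ _))] at h
  -- local-to-global
  have h := mulHeight₁_le_of_forall_absValue_le (K := K) ({0} : Finset (Fin 1)) (y := y)
    (x := fun _ ↦ J) (e := fun _ ↦ DY) (C := max 1 L) (le_max_left _ _)
    (fun v _ ↦ by rw [prod_singleton]; exact harch v)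
    (fun v hv ↦ by rw [prod_singleton]; exact hna v (isNonarchimedean v hv))
  rw [prod_singleton] at h
  rw [logHeight₁_eq_log_mulHeight₁, logHeight₁_eq_log_mulHeight₁, ← totalWeight_eq_finrank]
  have hpos : 0 < max 1 L := lt_of_lt_of_le one_pos (le_max_left _ _)
  calc Real.log (mulHeight₁ y) ≤ Real.log ((max 1 L) ^ totalWeight K * mulHeight₁ J ^ DY) :=
        Real.log_le_log (mulHeight₁_pos _) h
    _ = _ := by
        rw [Real.log_mul (by positivity) (by positivity), Real.log_pow, Real.log_pow]

end Global

/-! ### The Liouville estimate for the value of the auxiliary function at `q^ℓ` -/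

variable {p : ℕ} [Fact p.Prime]

/-- **Degree of `ℚ(q, J(q), J(q^ℓ))`.**  If `E ⊂ ℚ_p` is a subfield of finite degree containing
`J`, and `J_ℓ ∈ ℚ_p` satisfies `Φ(J_ℓ, J) = 0` for a monic `Φ ∈ ℤ[X][Y]` (in `X`), then `J_ℓ` is
integral over `E` and `[E(J_ℓ) : E] ≤ deg_X Φ`. [folklore] -/
theorem isIntegral_and_finrank_adjoin_le (E : IntermediateField ℚ ℚ_[p]) {J Jℓ : ℚ_[p]} (hJ : J ∈ E)
    (Φ : Polynomial (Polynomial ℤ)) (hmonic : Φ.Monic)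
    (hrel : (Φ.map (Polynomial.eval₂RingHom (Int.castRingHom ℚ_[p]) J)).eval Jℓ = 0) :
    IsIntegral E Jℓ ∧ Module.finrank E (IntermediateField.adjoin E {Jℓ}) ≤ Φ.natDegree := by
  -- the relation as a monic polynomial over `E`
  set JE : E := ⟨J, hJ⟩ with hJE
  set R : Polynomial E := Φ.map (Polynomial.aeval JE).toRingHom with hR
  have hRmonic : R.Monic := hmonic.map _
  have hcomp : (algebraMap E ℚ_[p]).comp (Polynomial.aeval JE).toRingHom =
      Polynomial.eval₂RingHom (Int.castRingHom ℚ_[p]) J := by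
    refine Polynomial.ringHom_ext (fun z ↦ by simp) ?_
    simp [hJE]
  have hReval : Polynomial.aeval Jℓ R = 0 := by
    rw [Polynomial.aeval_def, Polynomial.eval₂_eq_eval_map, hR, Polynomial.map_map, hcomp]
    exact hrel
  have hint : IsIntegral E Jℓ := ⟨R, hRmonic, by rwa [Polynomial.aeval_def] at hReval⟩
  refine ⟨hint, ?_⟩
  rw [IntermediateField.adjoin.finrank hint]
  have h1 : (minpoly E Jℓ).degree ≤ R.degree := minpoly.min E Jℓ hRmonic hReval
  have h2 : R.natDegree = Φ.natDegree := hmonic.natDegree_map _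
  rw [← h2]
  exact Polynomial.natDegree_le_natDegree h1

/-- **Fourth step: the Liouville lower bound for `F(q^ℓ)`.**  Let `q ∈ ℚ_p`, `0 < ‖q‖ < 1`, with `q`
and `J(q) = tateJ q` algebraic over `ℚ`.  There are `d₀ ≥ 1` and `c_q, c_J ≥ 0` such that for all
`ℓ ≥ 1`, all `Φ ∈ ℤ[X][Y]` monic in `X` with `deg_Y` of its coefficients `≤ D_Y` and
`Φ(J(q^ℓ), J(q)) = 0`, all finite `s`, integers `a_λ` and bounds `λ₁ ≤ B₁`, `λ₂ ≤ B₂` on `s`: if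
`v = Σ_{λ ∈ s} a_λ (q^ℓ)^{λ₁} (q^ℓ J(q^ℓ))^{λ₂} ≠ 0` then

`-log ‖v‖_p ≤ d₀ · deg_X Φ · (log⁺(Σ|a_λ|) + ℓ (B₁ + B₂) c_q + B₂ (log⁺ L(Φ) + D_Y c_J))`,

`L(Φ) = Σ_{m ≤ deg_X Φ} Σ_{i ≤ D_Y} |coeff|` (Nesterenko–Philippon Ch. 2 §2.5, fourth step:
Liouville's inequality Lemma 2.10 on `K = ℚ(q, J(q), J(q^ℓ))`, `[K:ℚ] ≤ d(q, J(q)) deg_X Φ`, with the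
height of `J(q^ℓ)` bounded through the modular relation, Lemma 2.8).
[cite: NesterenkoPhilippon2001, Ch. 2, §2.5] -/
theorem neg_log_norm_auxValue_le {q : ℚ_[p]} (hq : IsAlgebraic ℚ q) (hJ : IsAlgebraic ℚ (tateJ q)) :
    ∃ (d₀ : ℕ) (cq cJ : ℝ), 1 ≤ d₀ ∧ 0 ≤ cq ∧ 0 ≤ cJ ∧
      ∀ (ℓ : ℕ), 1 ≤ ℓ → ∀ (Φ : Polynomial (Polynomial ℤ)) (DY : ℕ), Φ.Monic →
        (∀ m, (Φ.coeff m).natDegree ≤ DY) →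
        (Φ.map (Polynomial.eval₂RingHom (Int.castRingHom ℚ_[p]) (tateJ q))).eval (tateJ (q ^ ℓ)) = 0 →
        ∀ (s : Finset (ℕ × ℕ)) (a : ℕ × ℕ → ℤ) (B₁ B₂ : ℕ), (∀ l ∈ s, l.1 ≤ B₁ ∧ l.2 ≤ B₂) →
          (∑ l ∈ s, (a l : ℚ_[p]) * (q ^ ℓ) ^ l.1 * (q ^ ℓ * tateJ (q ^ ℓ)) ^ l.2) ≠ 0 →
          -Real.log ‖∑ l ∈ s, (a l : ℚ_[p]) * (q ^ ℓ) ^ l.1 * (q ^ ℓ * tateJ (q ^ ℓ)) ^ l.2‖ ≤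
            d₀ * Φ.natDegree *
              (Real.log (max 1 (∑ l ∈ s, |(a l : ℝ)|)) + ℓ * (B₁ + B₂) * cq +
                B₂ * (Real.log (max 1 (∑ m ∈ range (Φ.natDegree + 1), ∑ i ∈ range (DY + 1),
                  |(((Φ.coeff m).coeff i : ℤ) : ℝ)|)) + DY * cJ)) := by
  classical
  -- the constants
  obtain ⟨cq, hcq0, hcq⟩ := exists_logHeight₁_le_of_isAlgebraic hq
  obtain ⟨cJ, hcJ0, hcJ⟩ := exists_logHeight₁_le_of_isAlgebraic hJ
  set E : IntermediateField ℚ ℚ_[p] := IntermediateField.adjoin ℚ {q, tateJ q} with hE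
  haveI hEfin : FiniteDimensional ℚ E :=
    IntermediateField.finiteDimensional_adjoin_pair hq.isIntegral hJ.isIntegral
  have hqE : q ∈ E := IntermediateField.subset_adjoin ℚ _ (Set.mem_insert q _)
  have hJE : tateJ q ∈ E :=
    IntermediateField.subset_adjoin ℚ _ (Set.mem_insert_of_mem q (Set.mem_singleton _))
  set d₀ := Module.finrank ℚ E with hd₀
  have hd₀pos : 0 < d₀ := Module.finrank_pos
  refine ⟨d₀, cq, cJ, hd₀pos, hcq0, hcJ0, ?_⟩
  intro ℓ hℓ Φ DY hmonic hDY hrel s a B₁ B₂ hB hv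
  -- the number field `K = E(J_ℓ)`
  set Jℓ := tateJ (q ^ ℓ) with hJℓ
  obtain ⟨hint, hdeg⟩ := isIntegral_and_finrank_adjoin_le E hJE Φ hmonic hrel
  set K := IntermediateField.adjoin E {Jℓ} with hK
  haveI : FiniteDimensional E K := IntermediateField.adjoin.finiteDimensional hint
  haveI hKfin : Module.Finite ℚ K := Module.Finite.trans E K
  haveI : NumberField K := NumberField.of_module_finite ℚ K
  -- its degree
  have hfinrank : Module.finrank ℚ K = d₀ * Module.finrank E K := (Module.finrank_mul_finrank ℚ E K).symm
  have hnK : (Module.finrank ℚ K : ℝ) ≤ d₀ * Φ.natDegree := by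
    rw [hfinrank]; push_cast; gcongr
  -- the elements `q, J, J_ℓ` of `K` and the embedding `σ : K → ℚ_p`
  set σ : K →+* ℚ_[p] := (algebraMap K ℚ_[p]) with hσ
  set qK : K := ⟨q, K.algebraMap_mem ⟨q, hqE⟩⟩ with hqK
  set JK : K := ⟨tateJ q, K.algebraMap_mem ⟨tateJ q, hJE⟩⟩ with hJK
  set yK : K := ⟨Jℓ, IntermediateField.mem_adjoin_simple_self E Jℓ⟩ with hyK
  have hσq : σ qK = q := rfl
  have hσJ : σ JK = tateJ q := rfl
  have hσy : σ yK = Jℓ := rfl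
  -- the element `x` with `σ x = v`
  set x : K := ∑ l ∈ s, (a l : K) * qK ^ (ℓ * (l.1 + l.2)) * yK ^ l.2 with hx
  have hσx : σ x = ∑ l ∈ s, (a l : ℚ_[p]) * (q ^ ℓ) ^ l.1 * (q ^ ℓ * tateJ (q ^ ℓ)) ^ l.2 := by
    rw [hx, map_sum]
    refine sum_congr rfl fun l _ ↦ ?_
    rw [map_mul, map_mul, map_pow, map_pow, map_intCast, hσq, hσy, hJℓ]
    ring
  have hx0 : x ≠ 0 := fun h ↦ hv (by rw [← hσx, h, map_zero])
  -- heights of `q`, `J`, `J_ℓ` in `K`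
  have hhq : logHeight₁ qK ≤ cq * Module.finrank ℚ K := hcq K σ qK hσq
  have hhJ : logHeight₁ JK ≤ cJ * Module.finrank ℚ K := hcJ K σ JK hσJ
  have hcompσ : σ.comp (Polynomial.aeval JK).toRingHom =
      Polynomial.eval₂RingHom (Int.castRingHom ℚ_[p]) (tateJ q) := by
    refine Polynomial.ringHom_ext (fun z ↦ by simp) ?_
    simp only [RingHom.coe_comp, Function.comp_apply, Polynomial.coe_eval₂RingHom,
      Polynomial.eval₂_X]
    rw [← hσJ]
    change σ (Polynomial.aeval JK (X : Polynomial ℤ)) = σ JK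
    rw [Polynomial.aeval_X]
  have hrelK : (Φ.map (Polynomial.aeval JK).toRingHom).eval yK = 0 := by
    apply σ.injective
    rw [Polynomial.eval_map, Polynomial.hom_eval₂, hcompσ, hσy, map_zero, ← Polynomial.eval_map]
    exact hrel
  have hhy := logHeight₁_root_le Φ hmonic hDY yK JK hrelK
  have hhx := logHeight₁_sum_intCast_mul_pow_mul_pow_le s a (fun l ↦ ℓ * (l.1 + l.2)) (fun l ↦ l.2)
    qK yK (D₁ := ℓ * (B₁ + B₂)) (D₂ := B₂)
    (fun l hl ↦ ⟨Nat.mul_le_mul_left ℓ (add_le_add (hB l hl).1 (hB l hl).2), (hB l hl).2⟩)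
  -- Liouville's inequality at the embedding `σ`
  have hLiou := neg_logHeight₁_le_log_norm_embedding σ hx0
  rw [hσx] at hLiou
  -- bookkeeping
  set n : ℝ := (Module.finrank ℚ K : ℝ) with hn
  set La : ℝ := Real.log (max 1 (∑ l ∈ s, |(a l : ℝ)|)) with hLa
  set LΦ : ℝ := Real.log (max 1 (∑ m ∈ range (Φ.natDegree + 1), ∑ i ∈ range (DY + 1),
    |(((Φ.coeff m).coeff i : ℤ) : ℝ)|)) with hLΦ
  have hLa0 : 0 ≤ La := Real.log_nonneg (le_max_left _ _)
  have hLΦ0 : 0 ≤ LΦ := Real.log_nonneg (le_max_left _ _)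
  have hn0 : 0 ≤ n := by positivity
  have e1 : ((ℓ * (B₁ + B₂) : ℕ) : ℝ) * logHeight₁ qK ≤ ((ℓ * (B₁ + B₂) : ℕ) : ℝ) * (cq * n) :=
    mul_le_mul_of_nonneg_left hhq (by positivity)
  have e2 : (DY : ℝ) * logHeight₁ JK ≤ DY * (cJ * n) := mul_le_mul_of_nonneg_left hhJ (by positivity)
  have e3 : (B₂ : ℝ) * logHeight₁ yK ≤ B₂ * (n * LΦ + DY * (cJ * n)) :=
    mul_le_mul_of_nonneg_left (hhy.trans (by linarith)) (by positivity)
  have e4 : logHeight₁ x ≤ n * (La + ℓ * (B₁ + B₂) * cq + B₂ * (LΦ + DY * cJ)) := by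
    have : logHeight₁ x ≤ n * La + ((ℓ * (B₁ + B₂) : ℕ) : ℝ) * (cq * n) +
        B₂ * (n * LΦ + DY * (cJ * n)) := by linarith
    push_cast at this
    linarith
  have hBk0 : 0 ≤ La + ℓ * (B₁ + B₂) * cq + B₂ * (LΦ + DY * cJ) := by positivity
  have e5 : n * (La + ℓ * (B₁ + B₂) * cq + B₂ * (LΦ + DY * cJ)) ≤
      (d₀ * Φ.natDegree : ℝ) * (La + ℓ * (B₁ + B₂) * cq + B₂ * (LΦ + DY * cJ)) :=
    mul_le_mul_of_nonneg_right hnK hBk0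
  linarith

end Literature.NumberTheory.Transcendental

end
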